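import Summits.ResolutionOfSingularities.ResolutionOfSingularities.Theorems.PurelyInseparableDim4ResConeHeavyLinePattern
import Summits.ResolutionOfSingularities.ResolutionOfSingularities.Theorems.PurelyInseparableDim4PhiLineSupercritical
import Summits.ResolutionOfSingularities.ResolutionOfSingularities.Theorems.PurelyInseparableDim4ResConeBInfKeepStep
import HarnessLib
import HarnessLib.Audit.Tags

/-!
# The `(p, p−1)` heavy line, STUB K_p (p-GENERIC): the KEEP-H step at a `(2)`-state — the carried heavy label passes to the child with
# the same heavy letter and `βs` STRICTLY smaller (cell `res-dim4-pi`, K2(p) lane, slice C `(p, p−1)`; CARD I-1-9/I-1-10 «THE HEAVY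
# LINE»; HOLDER WORD 2026-08-29 08:08Z «(p, p−1) D∞-type heavy line, p-GENERIC»; kernel hand res-dim4-p-7 g5)

[OURS · counted 0 · cell `res-dim4-pi` · K2(p) lane (holder res-dim4-p-12 g4); the p-generic twin of K₄ `ResCone.dInf_stub_keep`
(p707218); kernel hand res-dim4-p-7 g5.]  Nothing here proves K2(p), K2(7), `NoIsolatedTrap p p` or resolution of singularities in
dimension ≥ 4 / characteristic `p` — NOT proved.  AI kernel work, weaker than expert review.

INTERFACE (the `(p, p−1)` heavy-line invariants, numerals in the generic form of res-dim4-p-2 g5's `heavy_lose_step` / res-dim4-p-9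
g5's `heavy_entryFrame` with `n = p − r_h = d − 1`): for a prime `p ≥ 3`, `d + 1 = p`, a chain state `c k` with `G_k := F_k / x^{r_k}`
read at level `d` in the frame `(Σ_t L_{i t} x_t / 1)_i` of `𝒪 = K[x]_{(x)}`:
  EntryInv_p k h L M := (M·L = 1) ∧ L u₁ = e_h ∧ (y-rows annihilate resVertex (c k)) ∧ r_k h = 2 ∧ pts ≠ ∅ ∧ d! < δs ∧
                        d·αs ≤ (d − 2)·d!   («α ≤ (d−2)/d», (K-Φ1)-n with n = d − 1; at (5,4): α ≤ 1/2),
  RunInv_p  k h L M := EntryInv_p k h L M ∧ 0 < αs,      Φ := βs.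
(`α < 1`, needed by the abstract KEEP law, is re-derived at the isolated state by `PhiLine.alphaS_lt_of_isIsolated`, since
`r_h + d = p + 1 ≥ p`.)

* **`heavyLine_stub_keep (p)`** — on a witnessed isolated above-floor `Step0 p` chain with `x^{r₀} ∣ F₀`, shade `≡ d` and `e_G ≡ 2` from
  `k₀`, in the heavy class from `k₁ ≥ k₀` (one weight-`2` letter, the others `≤ 1`, `|r| ∈ {2,3}` — NAMED BINDER), at a `(2)`-state
  `k ≥ k₁` with heavy letter `h`: `RunInv_p k h L M ⟹ ∃ L′ M′, RunInv_p (k+1) h L′ M′ ∧ βs′ < βs`.  Composition = K₄'s at general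
  `p`: `heavyLine_two_state` (KEEP-H shape from the class) → `chain_direction_mem_resVertex` → R2
  `PhiLine.exists_keep_rechoice` → XIV/VII/II at `d < p` → at a `(2)`-state `ε = 1` and `R̃ ∈ (x_m^d)` folds into `x_m·Q′`
  (`heavyLine_two_state_newborn`; factorisations = res-dim4-p-9 g5's `tail_factorisation`/`tail_step_factorisation`) → res-dim4-p-11 g5's child-side XV `PhiLine.betaS_step_lt_of_keep_pow` with `n = d − 1` in the arrival
  frame (`arrival_left_inverse`), its inputs from (K-Φ1)-n at the isolated child → X with `ε := 1`, `R := 0` → XI/XIII.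
[cite: CossartJannsenSaito2020, Lemma 12.2 (5), Lemma 13.4 (3), Lemma 11.5, Thm. 8.16] [cite: CossartPiltant2008, (16), Prop. 4.2]
bears_on: LADDER-RESOLUTION:D157-DOOR2 (res-dim4-pi · K2(p) · slice C (p, p−1) heavy line STUB K_p).  Supports
stmt-ResolutionOfSingularities-16155 (helper).
-/

set_option linter.dupNamespace false

noncomputable section

namespace Summit.ResolutionOfSingularities.ResolutionOfSingularities.Theorems.PIDim4

namespace ResCone

open MvPolynomial Finset IsLocalRing
open Literature.AlgebraicGeometry.Resolution
open Literature.AlgebraicGeometry.Resolution.CentreBlowup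
open Literature.AlgebraicGeometry.Resolution.Hauser2010
open Literature.AlgebraicGeometry.Resolution.HauserPerlega2019
open Literature.AlgebraicGeometry.Resolution.WeightedOrder
open PointBlowup (additiveSubspace direction)

variable {K : Type} [Field K] (p : ℕ) [hp : Fact p.Prime] [CharP K p] [DecidableEq K]

/-- **STUB K_p of the `(p, p−1)` heavy line (KEEP-H step of the carried label at a `(2)`-state), p-GENERIC** — run frame at
`c k` (`|r_k| = 2`, `r_k h = 2`) ⟹ run frame at `c (k+1)` with the same heavy letter and `βs′ < βs`.  See the module docstring.
[cite: CossartJannsenSaito2020, Lemma 12.2 (5), Lemma 13.4 (3), Lemma 11.5] [cite: CossartPiltant2008, (16), Prop. 4.2] -/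
theorem heavyLine_stub_keep {c : ℕ → State K} {j : ℕ → Fin 4} {b : ℕ → Fin 4 → K}
    (hc : ∀ k, IsIsolated p (c k).F ∧ Step0 p (c k) (c (k + 1))) (hw : FreeTail.IsWitnessedChain p c j b)
    (hr0 : ∀ e ∈ (c 0).F.support, (c 0).r ≤ e) (hfloor : ∀ k, ordZero (c k).F ≠ p) {k₀ d : ℕ} (hdp : d + 1 = p) (hp3 : 3 ≤ p)
    (hshade : ∀ k, k₀ ≤ k → (c k).shade = (d : ℕ∞))
    (he : ∀ k, k₀ ≤ k → Module.finrank K (resVertex (c k)) = 2) {k₁ : ℕ} (hk₁ : k₀ ≤ k₁)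
    (hD : ∀ k, k₁ ≤ k → (∃ W, (c k).r W = 2 ∧ ∀ i, i ≠ W → (c k).r i ≤ 1) ∧
      (2 ≤ (c k).r.degree ∧ (c k).r.degree ≤ 3))
    {k : ℕ} (hk : k₁ ≤ k) (h2 : (c k).r.degree = 2) {h : Fin 4} {L : Fin (2 + 2) → Fin 4 → K}
    {M : Fin 4 → Fin (2 + 2) → K}
    (hinv : ((∀ t u, ∑ i, M t i * L i u = if t = u then 1 else 0) ∧ L (u1 2) = Pi.single h 1 ∧
        (∀ i, i ≠ u1 2 → i ≠ u2 2 → ∀ w ∈ resVertex (c k), ∑ t, L i t * w t = 0) ∧ (c k).r h = 2 ∧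
        (pts (fun i => algebraMap (MvPolynomial (Fin 4) K) (OriginLocalization K 4) (∑ t, C (L i t) * X t))
          (Ideal.span {algebraMap (MvPolynomial (Fin 4) K) (OriginLocalization K 4)
            ((c k).F.divMonomial (c k).r)}) d).Nonempty ∧
        Nat.factorial d < deltaS (fun i => algebraMap (MvPolynomial (Fin 4) K) (OriginLocalization K 4) (∑ t, C (L i t) * X t))
          (Ideal.span {algebraMap (MvPolynomial (Fin 4) K) (OriginLocalization K 4)
            ((c k).F.divMonomial (c k).r)}) d ∧
        d * alphaS (fun i => algebraMap (MvPolynomial (Fin 4) K) (OriginLocalization K 4) (∑ t, C (L i t) * X t))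
          (Ideal.span {algebraMap (MvPolynomial (Fin 4) K) (OriginLocalization K 4)
            ((c k).F.divMonomial (c k).r)}) d ≤ (d - 2) * Nat.factorial d) ∧
      0 < alphaS (fun i => algebraMap (MvPolynomial (Fin 4) K) (OriginLocalization K 4) (∑ t, C (L i t) * X t))
        (Ideal.span {algebraMap (MvPolynomial (Fin 4) K) (OriginLocalization K 4)
            ((c k).F.divMonomial (c k).r)}) d) :
    ∃ (L' : Fin (2 + 2) → Fin 4 → K) (M' : Fin 4 → Fin (2 + 2) → K),
      (((∀ t u, ∑ i, M' t i * L' i u = if t = u then 1 else 0) ∧ L' (u1 2) = Pi.single h 1 ∧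
          (∀ i, i ≠ u1 2 → i ≠ u2 2 → ∀ w ∈ resVertex (c (k + 1)), ∑ t, L' i t * w t = 0) ∧ (c (k + 1)).r h = 2 ∧
          (pts (fun i => algebraMap (MvPolynomial (Fin 4) K) (OriginLocalization K 4) (∑ t, C (L' i t) * X t))
            (Ideal.span {algebraMap (MvPolynomial (Fin 4) K) (OriginLocalization K 4)
            ((c (k + 1)).F.divMonomial (c (k + 1)).r)}) d).Nonempty ∧
          Nat.factorial d < deltaS (fun i => algebraMap (MvPolynomial (Fin 4) K) (OriginLocalization K 4) (∑ t, C (L' i t) * X t))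
            (Ideal.span {algebraMap (MvPolynomial (Fin 4) K) (OriginLocalization K 4)
            ((c (k + 1)).F.divMonomial (c (k + 1)).r)}) d ∧
          d * alphaS (fun i => algebraMap (MvPolynomial (Fin 4) K) (OriginLocalization K 4) (∑ t, C (L' i t) * X t))
            (Ideal.span {algebraMap (MvPolynomial (Fin 4) K) (OriginLocalization K 4)
            ((c (k + 1)).F.divMonomial (c (k + 1)).r)}) d ≤ (d - 2) * Nat.factorial d) ∧
        0 < alphaS (fun i => algebraMap (MvPolynomial (Fin 4) K) (OriginLocalization K 4) (∑ t, C (L' i t) * X t))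
          (Ideal.span {algebraMap (MvPolynomial (Fin 4) K) (OriginLocalization K 4)
            ((c (k + 1)).F.divMonomial (c (k + 1)).r)}) d) ∧
      betaS (fun i => algebraMap (MvPolynomial (Fin 4) K) (OriginLocalization K 4) (∑ t, C (L' i t) * X t))
        (Ideal.span {algebraMap (MvPolynomial (Fin 4) K) (OriginLocalization K 4)
            ((c (k + 1)).F.divMonomial (c (k + 1)).r)}) d <
        betaS (fun i => algebraMap (MvPolynomial (Fin 4) K) (OriginLocalization K 4) (∑ t, C (L i t) * X t))
        (Ideal.span {algebraMap (MvPolynomial (Fin 4) K) (OriginLocalization K 4)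
            ((c k).F.divMonomial (c k).r)}) d := by
  obtain ⟨⟨hM, hLu1, hy, hrh, hne, hδ, -⟩, hα0⟩ := hinv
  obtain ⟨e, rfl⟩ : ∃ e, d = e + 2 := ⟨d - 2, by omega⟩
  -- abbreviations
  set alg := algebraMap (MvPolynomial (Fin 4) K) (OriginLocalization K 4) with halg
  set G := (c k).F.divMonomial (c k).r with hGdef
  set G' := (c (k + 1)).F.divMonomial (c (k + 1)).r with hG'def
  have hk0 : k₀ ≤ k := hk₁.trans hk
  -- 1. the heavy-class tail facts at `k` and `k + 1`
  obtain ⟨hF, hd, hpo, -, hsupp⟩ := tail_factorisation hc hr0 hfloor hshade hk0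
  have hpr : p ≤ (c k).r.degree + (e + 2) := hpo.le
  have hk1 : k₀ ≤ k + 1 := hk0.trans (Nat.le_succ k)
  obtain ⟨hF₁, hd₁, -, -, -⟩ := tail_factorisation hc hr0 hfloor hshade hk1
  obtain ⟨hzero, -, hjh, hbh, hr₁h, -⟩ := heavyLine_two_state p hc hw hr0 hfloor hdp hshade hk₁ hD hk h2 hrh
  obtain ⟨hF', hd'⟩ := tail_step_factorisation hc hw hr0 hfloor hshade hk0
  have hbm : b k (j k) = 0 := (hw k).2.1
  have hhm : h ≠ j k := fun h' => hjh h'.symm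
  have hdG : ((e + 2 : ℕ) : ℕ∞) ≤ ordZero G := hd.symm.le
  have hJμ : Ideal.span {alg G} ≤ maximalIdeal (OriginLocalization K 4) ^ (e + 2) :=
    PhiLine.span_singleton_algebraMap_le_maximalIdeal_pow hdG
  -- (K-Φ1) at `c k` in the carried frame: `α < 1` (critical reading, `r_h + d = p + 1 ≥ p`)
  have hα1 : alphaS (fun i => alg (∑ t, C (L i t) * X t)) (Ideal.span {alg G}) (e + 2) < Nat.factorial (e + 2) :=
    (PhiLine.alphaS_lt_of_isIsolated (p := p) (d := e + 2) hF (hc k).1 (h := h) (by rw [hrh]; omega)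
      (fun i => alg (∑ t, C (L i t) * X t)) (span_range_frame_eq_maximalIdeal L M hM)
      (by simp only [hLu1, PhiLine.sum_C_single_mul_X]; rfl)).2
  -- 2. the step direction lies in `resVertex (c k)`, so the y-rows kill it
  have hdir : direction (j k) (b k) ∈ resVertex (c k) := chain_direction_mem_resVertex p hc hw hr0 hfloor hshade hk0
  have hrows : ∀ i, i ≠ u1 2 → i ≠ u2 2 → ∑ t, L i t * Function.update (b k) (j k) 1 t = 0 :=
    fun i hi1 hi2 => hy i hi1 hi2 _ hdir
  -- R2: re-choose `u₂ := x_{j k}`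
  obtain ⟨Lr, Mr, hMr, hLru1, hLru2, hLri, hnear, hner, hαr, hβr, hδr⟩ :=
    PhiLine.exists_keep_rechoice L M hM hLu1 (dir := Function.update (b k) (j k) 1) (Function.update_self _ _ _)
      (by rw [Function.update_of_ne hhm, hbh]) hrows hJμ hne hα0
  -- the y-rows of the re-chosen frame still lie in `(resVertex (c k))^⊥`
  have hyr : ∀ i, i ≠ u1 2 → i ≠ u2 2 → ∀ w ∈ resVertex (c k), ∑ t, Lr i t * w t = 0 := by
    intro i hi1 hi2 w hw'
    rw [hLri i hi2]
    exact hy i hi1 hi2 w hw'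
  obtain ⟨hArBr, hBrAr⟩ := matrix_inverses_of_leftInverse hMr
  -- 3. the departure label `G = Ψ(y) + Q` (XIV at `d < p`)
  obtain ⟨Ψ, hΨ, hΨA, Q, hQ, hGΨ⟩ := PhiLine.exists_label_of_yRows_annihilate p (d := e + 2) (by omega) hF hd hArBr hBrAr
    (he k hk0) (fun i hi1 hi2 w hw' => by simpa only [Matrix.of_apply] using hyr i hi1 hi2 w hw')
  -- the weak transform read in the arrival y-rows (VII)
  obtain ⟨Q', hH₀⟩ := PhiLine.chartTransform_translate_label (j := j k) hbm (fun i : Fin 2 => Lr (Fin.castAdd 2 i))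
    (fun i => hnear _ (castAdd_ne_u2 i)) hΨ hQ (G := G) (by simpa only [Matrix.of_apply] using hGΨ) hdG
  -- the child residual `G' = ε · H₀ + R` (II + the step factorisation); at a `(2)`-state `ε = 1`
  obtain ⟨R, hstep, hRmem⟩ := PhiLine.step_F_eq_monomial_mul_residual (p := p) (d := e + 2) hF hdG hpr (j k) hbm
  rw [hF', monomial_one_mul_cancel_left_iff] at hstep
  obtain ⟨hr'm, -, hndm, -⟩ := heavyLine_two_state_newborn (K := K) p hdp hp3 h2 hhm (b := b k) hbh hrh
  have hRm : R ∈ Ideal.span {(X (j k) : MvPolynomial (Fin 4) K) ^ (e + 2)} := by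
    have := hRmem (j k) hndm
    rwa [hr'm, show p - 1 = e + 2 by omega] at this
  have hεone : (∏ i ∈ Finset.univ.filter (fun i => b k i ≠ 0), (X i + C (b k i)) ^ (c k).r i : MvPolynomial (Fin 4) K) = 1 := by
    refine Finset.prod_eq_one fun i hi => ?_
    rw [Finset.mem_filter] at hi
    have hih : i ≠ h := fun hih => hi.2 (hih ▸ hbh)
    rw [hzero i hih, pow_zero]
  rw [hεone, one_mul] at hstep
  -- 4. the arrival frame; (K-Φ1)-n at the isolated CHILD read in it; res-dim4-p-11 g5's child-side KEEP law with `n = d − 1`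
  set La : Fin (2 + 2) → Fin 4 → K :=
    Function.update (fun i => Function.update (Lr i) (j k) 0) (u2 2) (Pi.single (j k) 1) with hLa
  have hLau2 : La (u2 2) = Pi.single (j k) 1 := by rw [hLa, Function.update_self]
  have hLai : ∀ i, i ≠ u2 2 → La i = Function.update (Lr i) (j k) 0 := fun i hi => by
    rw [hLa, Function.update_of_ne hi]
  have hLau1 : La (u1 2) = Pi.single h 1 := by
    rw [hLai _ u1_ne_u2, hLru1, PhiLine.update_single_of_ne hhm]
  have hMa := arrival_left_inverse hMr (piv := u2 2) hLru2 hLau2 hLai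
  have hchild := PhiLine.mul_alphaS_le_of_isIsolated (p := p) (d := e + 2) (n := e + 1) hF₁ (hc (k + 1)).1 (h := h)
    (by rw [hr₁h]; omega) (by omega) (fun i => alg (∑ t, C (La i t) * X t)) (span_range_frame_eq_maximalIdeal La _ hMa)
    (by simp only [hLau1, PhiLine.sum_C_single_mul_X]; rfl)
  have hα' : (e + 2) * (alphaS (fun i => alg (∑ t, C (La i t) * X t)) (Ideal.span {alg G'}) (e + 2) + 1) ≤
      (e + 1) * Nat.factorial (e + 2) := by
    have hb : (e + 2) * alphaS (fun i => alg (∑ t, C (La i t) * X t)) (Ideal.span {alg G'}) (e + 2) ≤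
        (e + 1 - 1) * Nat.factorial (e + 2) := hchild.2
    have hfac : e + 2 ≤ Nat.factorial (e + 2) := Nat.self_le_factorial _
    rw [show e + 1 - 1 = e by omega] at hb
    nlinarith [hb, hfac]
  obtain ⟨hnea, hαa, hβa⟩ := PhiLine.betaS_step_lt_of_keep_pow (p := p) (d := e + 2) (n := e + 1) hF hd (by omega) hpr hhm
    (by rw [hrh]; omega) (by omega) (by omega) hbm hbh Lr La Mr _ hMr hMa hLru1 hLru2 hnear hLau2 hLai hner
    (by rw [hδr]; exact hδ) (by rw [hαr]; exact hα1) hF' hd' hchild.1 hα'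
  -- 5. the arrival frame is again a label after re-adapting its y-rows along `u₁` (X with `ε := 1`, `R := 0`) …
  obtain ⟨hAB, hBA⟩ := matrix_inverses_of_leftInverse hMa
  have hT := PhiLine.two_le_finrank_additiveSubspace_of_resVertex hF₁ hd₁ (he (k + 1) hk1)
  have hrowsA : (fun i : Fin 2 => ∑ t, C ((Matrix.of fun (i : Fin 4) (t : Fin 4) => La i t) (Fin.castAdd 2 i) t) * X t) =
      fun i : Fin 2 => ∑ t, C (Function.update (Lr (Fin.castAdd 2 i)) (j k) 0 t) * X t := by
    funext i
    simp only [Matrix.of_apply, hLai _ (castAdd_ne_u2 i)]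
  obtain ⟨S, hS⟩ := Ideal.mem_span_singleton'.mp hRm
  have hXd : (X (j k) : MvPolynomial (Fin 4) K) ^ (e + 2) = X (j k) * X (j k) ^ (e + 1) := by ring
  have hG'A : G' = aeval (fun i : Fin 2 => ∑ t, C ((Matrix.of fun (i : Fin 4) (t : Fin 4) => La i t) (Fin.castAdd 2 i) t) * X t) Ψ +
      X (j k) * (Q' + X (j k) ^ (e + 1) * S) := by
    rw [hrowsA, hG'def, hstep, hH₀, ← hS, hXd]; ring
  have hAu2 : (Matrix.of fun (i : Fin 4) (t : Fin 4) => La i t) (u2 2) = Pi.single (j k) 1 := by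
    funext t; rw [Matrix.of_apply, hLau2]
  have hAu1 : (Matrix.of fun (i : Fin 4) (t : Fin 4) => La i t) (u1 2) = Pi.single h 1 := by
    funext t; rw [Matrix.of_apply, hLau1]
  obtain ⟨lam, A', B', hA'B', hB'A', -, hA'u1, -, hne'', hδ'', hα'', hβ''⟩ :=
    PhiLine.exists_label_readaptation_of_step p (d := e + 2) (by omega) hAB hBA (u := u2 2)
      (Finset.mem_insert_of_mem (Finset.mem_singleton_self _)) hAu2 hAu1 (ε := 1) (R := 0) (e := e + 2) (by omega) le_rfl
      (by rw [one_mul, add_zero]; exact hG'A) hd' (by rw [map_one]; exact one_ne_zero) (Ideal.zero_mem _)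
      rfl hΨ hΨA hT hnea (by simp only [Matrix.of_apply]; rw [hαa, hαr]; exact hα0)
      (by simp only [Matrix.of_apply]; rw [hαa, hαr]; exact hα1)
  simp only [Matrix.of_apply] at hα'' hβ'' hne'' hδ''
  -- … and its y-rows lie in `(resVertex (c (k+1)))^⊥` (XIII)
  have hy'' := PhiLine.yRows_annihilate_of_label p (d := e + 2) (by omega) hF₁ hd₁ hA'B' hB'A' (he (k + 1) hk1) hδ''
  refine ⟨A', B', ⟨⟨fun t u => ?_, ?_, fun i hi1 hi2 w hw' => hy'' i hi1 hi2 w hw', hr₁h, hne'', hδ'', ?_⟩, ?_⟩, ?_⟩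
  · have h1 := congrFun (congrFun hB'A' t) u
    rw [Matrix.mul_apply, Matrix.one_apply] at h1
    exact h1
  · rw [hA'u1, hAu1]
  · have hb : (e + 2) * alphaS (fun i => alg (∑ t, C (La i t) * X t)) (Ideal.span {alg G'}) (e + 2) ≤
        (e + 1 - 1) * Nat.factorial (e + 2) := hchild.2
    rw [show e + 1 - 1 = e + 2 - 2 by omega] at hb
    rw [hα'']; exact hb
  · rw [hα'', hαa, hαr]; exact hα0
  · rw [hβ'', ← hβr]; exact hβa

end ResCone

end Summit.ResolutionOfSingularities.ResolutionOfSingularities.Theorems.PIDim4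

end
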